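import Mathlib
import Summits.QuantumFields.YangMills.Theorems.TransportFieldVacuumRightShift
import Literature.MathematicalPhysics.QuantumLattice.SU2Haar
import HarnessLib

/-!
# Transport-field regularity kit, tranche 4a: colour algebra of `𝔰𝔲(2)` — colour inversion, conjugation covariance of Print's chart

For the `IsPhys (XΩ)` clause of `CovariantCurrentDoor.CurrentStatePhysical` ⟨stmt-QuantumFields-23381⟩ (and `stub_robertsonB` ⟨23380⟩): the
current's direction at a site is the COLOUR VECTOR `c(M)_a = Re(−i/2 · tr(σ_a M))` of the smoothed field `M = B(U)_s`, fed into Print's chart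
`expPauli`.  Gauge covariance of the current rests on three algebraic facts proved here for `2×2` complex matrices `M` that are
skew-Hermitian and traceless (`M ∈ 𝔰𝔲(2)`):
* `su2Coord_colour` — COLOUR INVERSION: `su2Coord (c(M)) = M` (the colour vector is the inverse of Print's coordinates `x ↦ iΣ x_aσ_a`);
* `conjTranspose_conj_su2`, `trace_conj_su2`, `conjTranspose_sub_inv_su2`, `trace_sub_inv_su2`, … — `𝔰𝔲(2)` is stable under `M ↦ hMh⁻¹`
  (`h ∈ SU(2)`), contains `P − P⁻¹` for `P ∈ SU(2)`, and is a real vector space (the building blocks of `M₀` and of the smoothing `T_U`);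
* ★ `expPauli_colour_conj` — `expPauli (t • c(hMh⁻¹)) = h · expPauli (t • c(M)) · h⁻¹`: in colour coordinates the chart is `Ad`-equivariant.
HONEST FRAMING: matrix algebra only; no claim about the cruxes, K2a or the YM mass gap.  No `sorry`, no new axiom, no new definition.
References: [cite: Balaban1985UV3, p. 260]; [cite: Creutz2022, Ch. 11].
-/

set_option autoImplicit false

noncomputable section

open NormedSpace
open scoped BigOperators Matrix.Norms.Frobenius
open Literature.MathematicalPhysics.QuantumLattice (su2_apply_10 su2_apply_11)
open Literature.MathematicalPhysics.QuantumFieldTheory.Balaban1983to89.B10Eq18SigmaSU2 (pauli su2Coord)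
open Literature.MathematicalPhysics.QuantumFieldTheory.Balaban1983to89.B10Eq18SigmaSU2Haar (expPauli coe_expPauli)
open Complex

namespace Summit.QuantumFields.YangMills.Theorems.TransportField

open Summit.QuantumFields.YangMills.Theorems.FemtoTransferGap

/-! ## §1 Colour inversion -/

/-- The three Pauli traces of a `2×2` matrix. [cite: Balaban1985UV3, p. 260] -/
theorem trace_pauli_mul (M : Matrix (Fin 2) (Fin 2) ℂ) :
    (pauli 0 * M).trace = M 1 0 + M 0 1 ∧ (pauli 1 * M).trace = -I * M 1 0 + I * M 0 1 ∧ (pauli 2 * M).trace = M 0 0 - M 1 1 := by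
  refine ⟨?_, ?_, ?_⟩
  · rw [Matrix.trace_fin_two, Matrix.mul_apply, Matrix.mul_apply]
    simp [pauli, Fin.sum_univ_two]
    try ring
  · rw [Matrix.trace_fin_two, Matrix.mul_apply, Matrix.mul_apply]
    simp [pauli, Fin.sum_univ_two]
  · rw [Matrix.trace_fin_two, Matrix.mul_apply, Matrix.mul_apply]
    simp [pauli, Fin.sum_univ_two]
    try ring

/-- ★ **COLOUR INVERSION**: for a skew-Hermitian traceless `M`, `su2Coord (a ↦ Re(−i/2·tr(σ_a M))) = M`. [cite: Balaban1985UV3, p. 260] -/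
theorem su2Coord_colour (M : Matrix (Fin 2) (Fin 2) ℂ) (hH : M.conjTranspose = -M) (htr : M.trace = 0) :
    su2Coord (fun a : Fin 3 => (-(I / 2) * (pauli a * M).trace).re) = M := by
  obtain ⟨h0, h1, h2⟩ := trace_pauli_mul M
  -- entry relations from `Mᴴ = −M` and `tr M = 0`
  have e00 : (starRingEnd ℂ) (M 0 0) = -M 0 0 := by
    have := congrFun (congrFun hH 0) 0
    simpa [Matrix.conjTranspose_apply] using this
  have e10 : (starRingEnd ℂ) (M 0 1) = -M 1 0 := by
    have := congrFun (congrFun hH 1) 0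
    simpa [Matrix.conjTranspose_apply] using this
  have e11 : M 1 1 = -M 0 0 := by
    have : M 0 0 + M 1 1 = 0 := by simpa [Matrix.trace, Fin.sum_univ_two] using htr
    linear_combination this
  have r00 : (M 0 0).re = 0 := by
    have := congrArg Complex.re e00
    simp only [Complex.conj_re, Complex.neg_re] at this
    linarith
  have r10re : (M 1 0).re = -(M 0 1).re := by
    have := congrArg Complex.re e10
    simp only [Complex.conj_re, Complex.neg_re] at this
    linarith
  have r10im : (M 1 0).im = (M 0 1).im := by
    have := congrArg Complex.im e10
    simp only [Complex.conj_im, Complex.neg_im] at this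
    linarith
  have r11re : (M 1 1).re = 0 := by rw [e11, Complex.neg_re, r00, neg_zero]
  have r11im : (M 1 1).im = -(M 0 0).im := by rw [e11, Complex.neg_im]
  have c0 : ((-(I / 2) * (pauli 0 * M).trace).re : ℂ) * I + ((-(I / 2) * (pauli 1 * M).trace).re : ℂ) = M 0 1 := by
    rw [h0, h1]; apply Complex.ext <;> simp [r10re, r10im] <;> ring
  have c1 : ((-(I / 2) * (pauli 0 * M).trace).re : ℂ) * I - ((-(I / 2) * (pauli 1 * M).trace).re : ℂ) = M 1 0 := by
    rw [h0, h1]; apply Complex.ext <;> simp [r10re, r10im] <;> ring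
  have c2 : ((-(I / 2) * (pauli 2 * M).trace).re : ℂ) * I = M 0 0 := by
    rw [h2]
    apply Complex.ext
    · simp [r00, r11re, r11im]
    · simp [r00, r11re, r11im]; ring
  unfold su2Coord
  rw [c0, c1, c2, ← e11]
  exact (Matrix.eta_fin_two M).symm

/-! ## §2 `𝔰𝔲(2)` is stable under `SU(2)`-conjugation, real scalars, sums; `P − P⁻¹ ∈ 𝔰𝔲(2)` -/

/-- The matrix of `h⁻¹` is the conjugate transpose of the matrix of `h` (`h ∈ SU(2)`). [folklore] -/
theorem su2Rep_inv_eq_conjTranspose (h : SU2) : su2Rep (h⁻¹) = (su2Rep h).conjTranspose := by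
  rw [← Matrix.star_eq_conjTranspose]
  rfl

/-- `(hMh⁻¹)ᴴ = −hMh⁻¹` for `Mᴴ = −M`, `h ∈ SU(2)`. [folklore] -/
theorem conjTranspose_conj_su2 (h : SU2) {M : Matrix (Fin 2) (Fin 2) ℂ} (hH : M.conjTranspose = -M) :
    (su2Rep h * M * su2Rep (h⁻¹)).conjTranspose = -(su2Rep h * M * su2Rep (h⁻¹)) := by
  rw [su2Rep_inv_eq_conjTranspose, Matrix.conjTranspose_mul, Matrix.conjTranspose_mul, Matrix.conjTranspose_conjTranspose, hH,
    ← Matrix.mul_assoc, Matrix.mul_neg, Matrix.neg_mul]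

/-- `tr(hMh⁻¹) = tr M`. [folklore] -/
theorem trace_conj_su2 (h : SU2) (M : Matrix (Fin 2) (Fin 2) ℂ) : (su2Rep h * M * su2Rep (h⁻¹)).trace = M.trace := by
  rw [Matrix.trace_mul_cycle, ← map_mul, inv_mul_cancel, map_one, Matrix.one_mul]

/-- `(h⁻¹Mh)ᴴ = −h⁻¹Mh` (the backward-transported slot of the smoothing). [folklore] -/
theorem conjTranspose_conj_su2' (h : SU2) {M : Matrix (Fin 2) (Fin 2) ℂ} (hH : M.conjTranspose = -M) :
    (su2Rep (h⁻¹) * M * su2Rep h).conjTranspose = -(su2Rep (h⁻¹) * M * su2Rep h) := by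
  simpa only [inv_inv] using conjTranspose_conj_su2 (h⁻¹) hH

/-- `tr(h⁻¹Mh) = tr M`. [folklore] -/
theorem trace_conj_su2' (h : SU2) (M : Matrix (Fin 2) (Fin 2) ℂ) : (su2Rep (h⁻¹) * M * su2Rep h).trace = M.trace := by
  simpa only [inv_inv] using trace_conj_su2 (h⁻¹) M

/-- `(P − P⁻¹)ᴴ = −(P − P⁻¹)` for `P ∈ SU(2)`. [folklore] -/
theorem conjTranspose_sub_inv_su2 (P : SU2) : (su2Rep P - su2Rep (P⁻¹)).conjTranspose = -(su2Rep P - su2Rep (P⁻¹)) := by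
  rw [Matrix.conjTranspose_sub, su2Rep_inv_eq_conjTranspose, Matrix.conjTranspose_conjTranspose, neg_sub]

/-- `tr(P − P⁻¹) = 0` for `P ∈ SU(2)` (the trace of an `SU(2)` matrix is real). [folklore] -/
theorem trace_sub_inv_su2 (P : SU2) : (su2Rep P - su2Rep (P⁻¹)).trace = 0 := by
  rw [Matrix.trace_sub, su2Rep_inv_eq_conjTranspose, Matrix.trace_conjTranspose]
  have htr : (su2Rep P).trace = (P : Matrix (Fin 2) (Fin 2) ℂ) 0 0 + (starRingEnd ℂ) ((P : Matrix (Fin 2) (Fin 2) ℂ) 0 0) := by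
    rw [show (su2Rep P).trace = (P : Matrix (Fin 2) (Fin 2) ℂ) 0 0 + (P : Matrix (Fin 2) (Fin 2) ℂ) 1 1 from
      Matrix.trace_fin_two _, su2_apply_11]
  rw [htr, Complex.star_def, map_add, Complex.conj_conj]
  ring

/-- The seed matrix `M₀ = Re tr P · ½(P − P⁻¹)` is skew-Hermitian. [folklore] -/
theorem conjTranspose_seed_su2 (P : SU2) :
    (((su2Rep P).trace.re : ℂ) • ((1 / 2 : ℂ) • (su2Rep P - su2Rep (P⁻¹)))).conjTranspose =
      -(((su2Rep P).trace.re : ℂ) • ((1 / 2 : ℂ) • (su2Rep P - su2Rep (P⁻¹)))) := by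
  have h1 : star ((su2Rep P).trace.re : ℂ) = ((su2Rep P).trace.re : ℂ) := Complex.conj_ofReal _
  have h2 : star (1 / 2 : ℂ) = 1 / 2 := by
    rw [Complex.star_def, map_div₀, map_one, map_ofNat]
  rw [Matrix.conjTranspose_smul, Matrix.conjTranspose_smul, conjTranspose_sub_inv_su2, h1, h2, smul_neg, smul_neg]

/-- The seed matrix is traceless. [folklore] -/
theorem trace_seed_su2 (P : SU2) :
    (((su2Rep P).trace.re : ℂ) • ((1 / 2 : ℂ) • (su2Rep P - su2Rep (P⁻¹)))).trace = 0 := by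
  rw [Matrix.trace_smul, Matrix.trace_smul, trace_sub_inv_su2, smul_zero, smul_zero]

/-! ## §3 ★ Print's chart is `Ad`-equivariant in colour coordinates -/

/-- The colour vector of `M` through `EuclideanSpace.equiv`: its `ofLp` is the plain function. [folklore] -/
theorem ofLp_colour (M : Matrix (Fin 2) (Fin 2) ℂ) :
    WithLp.ofLp ((EuclideanSpace.equiv (Fin 3) ℝ).symm fun a : Fin 3 => (-(I / 2) * (pauli a * M).trace).re) =
      fun a : Fin 3 => (-(I / 2) * (pauli a * M).trace).re := rfl

/-- The matrix of `expPauli (t • c(M))` is `exp(tM)` for `M ∈ 𝔰𝔲(2)`. [cite: Balaban1985UV3, p. 260] -/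
theorem coe_expPauli_smul_colour (M : Matrix (Fin 2) (Fin 2) ℂ) (hH : M.conjTranspose = -M) (htr : M.trace = 0) (t : ℝ) :
    ((expPauli (t • (EuclideanSpace.equiv (Fin 3) ℝ).symm fun a : Fin 3 => (-(I / 2) * (pauli a * M).trace).re) : SU2) :
        Matrix (Fin 2) (Fin 2) ℂ) = exp ((t : ℂ) • M) := by
  rw [coe_expPauli_smul, ofLp_colour, su2Coord_colour M hH htr]

/-- ★ **`expPauli (t • c(hMh⁻¹)) = h · expPauli (t • c(M)) · h⁻¹`** for `M ∈ 𝔰𝔲(2)`, `h ∈ SU(2)`. [cite: Balaban1985UV3, p. 260] -/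
theorem expPauli_colour_conj (h : SU2) (M : Matrix (Fin 2) (Fin 2) ℂ) (hH : M.conjTranspose = -M) (htr : M.trace = 0) (t : ℝ) :
    expPauli (t • (EuclideanSpace.equiv (Fin 3) ℝ).symm fun a : Fin 3 => (-(I / 2) * (pauli a * (su2Rep h * M * su2Rep (h⁻¹))).trace).re) =
      h * expPauli (t • (EuclideanSpace.equiv (Fin 3) ℝ).symm fun a : Fin 3 => (-(I / 2) * (pauli a * M).trace).re) * h⁻¹ := by
  refine Subtype.ext ?_
  have hcoe : (((h * expPauli (t • (EuclideanSpace.equiv (Fin 3) ℝ).symm fun a : Fin 3 => (-(I / 2) * (pauli a * M).trace).re) * h⁻¹ :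
      SU2)) : Matrix (Fin 2) (Fin 2) ℂ) =
      su2Rep h * ((expPauli (t • (EuclideanSpace.equiv (Fin 3) ℝ).symm fun a : Fin 3 => (-(I / 2) * (pauli a * M).trace).re) : SU2) :
        Matrix (Fin 2) (Fin 2) ℂ) * su2Rep (h⁻¹) := rfl
  have hunit : IsUnit (su2Rep h) := by
    rw [Matrix.isUnit_iff_isUnit_det]
    have : (h : Matrix (Fin 2) (Fin 2) ℂ).det = 1 := (Matrix.mem_specialUnitaryGroup_iff.mp h.2).2
    change IsUnit ((h : Matrix (Fin 2) (Fin 2) ℂ).det)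
    rw [this]; exact isUnit_one
  rw [hcoe, coe_expPauli_smul_colour _ (conjTranspose_conj_su2 h hH) (by rw [trace_conj_su2, htr]) t,
    coe_expPauli_smul_colour M hH htr t, su2Rep_inv_eq_matrix_inv,
    show (t : ℂ) • (su2Rep h * M * (su2Rep h)⁻¹) = su2Rep h * ((t : ℂ) • M) * (su2Rep h)⁻¹ by
      rw [Matrix.mul_smul, Matrix.smul_mul]]
  exact Matrix.exp_conj _ _ hunit

end Summit.QuantumFields.YangMills.Theorems.TransportField

end
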